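import Summits.RiemannHypothesis.RiemannHypothesis.Theorems.MotivicDoorDecreeOrderOne
import HarnessLib

/-!
# `N` off `u = 1` is the positive measure `Σ_n Λ(n) n^{-1/2} δ_n + w(log u) dlog u`; the `½ log` law

Connes–Consani motivic door, cc-3 gen 17, part 2 (RH-free; no zero of `ζ` enters; primes only
through the finite window sums of the explicit `N`-formula).  Framing: lottery ticket at the motivic
door; RH probability negligible; consolation prizes are real: a new semi-local Weil-positivity
theorem, or a located gap in the Connes–Consani programme, plus the ff-door theorem.  VERDICT
(standing): `Nonempty ArithmeticWeilSurface` is a restatement of RH in structure clothing, not a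
different-looking hypothesis.

PRINTED (Connes, Essay, arXiv:1509.05576 p. 14 l. 45–49, eq. (27)): "`N(u) = dφ(u)/du + κ(u)`,
`φ(u) := Σ_{n<u} n Λ(n)`, where `κ(u)` is the distribution which appears in the explicit formula"
— atoms at the prime powers plus the archimedean distribution; p. 15 l. 44–47:
"`N(1) ∼ −½ E log E`".

PROVED here (additive side `u = e^t`, `N = ccN` on `toMul κ`, unitary normalisation `n^{-1/2}`;
`w = weilArchDensity = e^{t/2}/(2 sinh t)`):
* `ccN_toMul_eq_sum_add_integral`: on the hyperplane `κ(0) = 0` of real Weil tests,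
  `N(toMul κ) = Σ_{log n<2a} Λ(n) n^{-1/2} κ(log n) + ∫₀^∞ w κ` — a positive (non-finite) measure,
  integrating `κ` because `κ` vanishes at `0` to first order; `sum_vonMangoldt_mul_le_ccN_toMul`,
  `integral_weilArchDensity_mul_le_ccN_toMul`: each side is dominated by `N` for `κ ≥ 0`;
* `abs_ccN_toMul_sub_vonMangoldt_le`: THE ATOM AT `u = n` HAS MASS `Λ(n) n^{-1/2}`:
  `|N(toMul κ) − Λ(n) n^{-1/2}| ≤ 2ε·w(log n − ε)` for `0 ≤ κ ≤ 1` with `κ(log n) = 1` living in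
  `|t − log n| < ε ≤ log(1 + 1/n)` (no other `log m` there: `oo_nat_eq_of_abs_log_sub_lt`);
* `exists_ccN_toMul_ge_one_of_pos`: tests `0 ≤ κ ≤ ε` off `(0, log 2)` with `N(toMul κ) ≥ 1`;
* `exists_tendsto_ccN_toMul_div_log`: for the plateau family `κ_δ` of
  `MotivicDoorDecreeOrderOne`, `N(toMul κ_δ)/log(1/δ) → ½` as `δ → 0⁺` — the same `½` as in
  `−½ E log E`.
-/

noncomputable section

set_option linter.dupNamespace false

open Complex Set MeasureTheory Filter Topology Literature.NumberTheory.LFunctions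
open Literature.NumberTheory.ConnesConsani2019
open Summit.RiemannHypothesis.RiemannHypothesis.Theorems.MotivicDoor.ArchLogLaplacian
open scoped Real ComplexConjugate ArithmeticFunction.vonMangoldt

namespace Summit.RiemannHypothesis.RiemannHypothesis.Theorems.MotivicDoor.ConnesConsani

variable {κ : ℝ → ℝ}

/-! ## 1. On the hyperplane `κ(0) = 0`, `N` is the measure `Σ Λ(n) n^{-1/2} δ_{log n} + w dt` -/

/-- **`N` is a positive measure on `{κ(0) = 0}`.**  For a real Weil test `κ` with `κ(0) = 0`
vanishing on `[2a, ∞)`: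
`N(toMul κ) = Σ_{log n < 2a} Λ(n) n^{-1/2} κ(log n) + ∫₀^∞ w(t) κ(t) dt` — the Dirac masses at the
prime powers plus the archimedean density; `w κ` is integrable at `0⁺` because `κ` vanishes there
to first order.  PROVED. -/
theorem ccN_toMul_eq_sum_add_integral (hκ : IsWeilTest fun t ↦ (κ t : ℂ)) (hκ0 : κ 0 = 0) {a : ℝ}
    (hκa : ∀ t, 2 * a ≤ t → κ t = 0) :
    ccN (toMul κ) = (∑ n ∈ weilPrimeIndex a, (Λ n : ℝ) / Real.sqrt n * κ (Real.log n)) +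
      ∫ t in Ioi (0 : ℝ), weilArchDensity t * κ t := by
  have h := two_mul_ccN_toMul_eq_markov hκ hκa
  have hI : ∫ t in Ioi (0 : ℝ), weilArchDensity t * (κ 0 - κ t) =
      -∫ t in Ioi (0 : ℝ), weilArchDensity t * κ t := by
    rw [← integral_neg]
    exact setIntegral_congr_fun measurableSet_Ioi fun t _ ↦ by rw [hκ0]; ring
  have hS : ∑ n ∈ weilPrimeIndex a, (Λ n : ℝ) / Real.sqrt n * (κ 0 - κ (Real.log n)) =
      -∑ n ∈ weilPrimeIndex a, (Λ n : ℝ) / Real.sqrt n * κ (Real.log n) := by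
    rw [← Finset.sum_neg_distrib]
    exact Finset.sum_congr rfl fun n _ ↦ by rw [hκ0]; ring
  rw [hI, hS, hκ0, mul_zero] at h
  linarith

/-- The prime side is dominated: `κ ≥ 0`, `κ(0) = 0` ⇒
`Σ_{log n < 2a} Λ(n) n^{-1/2} κ(log n) ≤ N(toMul κ)`.  PROVED. -/
theorem sum_vonMangoldt_mul_le_ccN_toMul (hκ : IsWeilTest fun t ↦ (κ t : ℂ)) (hnn : ∀ t, 0 ≤ κ t)
    (hκ0 : κ 0 = 0) {a : ℝ} (hκa : ∀ t, 2 * a ≤ t → κ t = 0) :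
    ∑ n ∈ weilPrimeIndex a, (Λ n : ℝ) / Real.sqrt n * κ (Real.log n) ≤ ccN (toMul κ) := by
  rw [ccN_toMul_eq_sum_add_integral hκ hκ0 hκa]
  have hI : 0 ≤ ∫ t in Ioi (0 : ℝ), weilArchDensity t * κ t :=
    setIntegral_nonneg measurableSet_Ioi fun t ht ↦ mul_nonneg (weilArchDensity_pos ht).le (hnn t)
  linarith

/-- The archimedean side is dominated: `κ ≥ 0`, `κ(0) = 0` ⇒ `∫₀^∞ w κ ≤ N(toMul κ)`.  PROVED. -/
theorem integral_weilArchDensity_mul_le_ccN_toMul (hκ : IsWeilTest fun t ↦ (κ t : ℂ))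
    (hnn : ∀ t, 0 ≤ κ t) (hκ0 : κ 0 = 0) :
    ∫ t in Ioi (0 : ℝ), weilArchDensity t * κ t ≤ ccN (toMul κ) := by
  obtain ⟨R, hR0, hR⟩ := exists_eq_zero_of_lt_abs_of_isWeilTest hκ
  have ha : ∀ t, 2 * ((R + 1) / 2) ≤ t → κ t = 0 := fun t ht ↦
    hR t (by rw [abs_of_nonneg (by linarith)]; linarith)
  have hP : 0 ≤ ∑ n ∈ weilPrimeIndex ((R + 1) / 2), (Λ n : ℝ) / Real.sqrt n * κ (Real.log n) :=
    Finset.sum_nonneg fun n _ ↦ mul_nonneg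
      (div_nonneg ArithmeticFunction.vonMangoldt_nonneg (Real.sqrt_nonneg _)) (hnn _)
  rw [ccN_toMul_eq_sum_add_integral hκ hκ0 ha]
  linarith

/-! ## 2. Arbitrarily small tests with `N ≥ 1`; the `½ log(1/δ)` limit law -/

/-- **Arbitrarily small tests with `N ≥ 1`.**  For every `ε > 0` there is a real Weil test
`0 ≤ κ ≤ ε` vanishing off `(0, log 2)` with `N(toMul κ) ≥ 1`.  PROVED. -/
theorem exists_ccN_toMul_ge_one_of_pos {ε : ℝ} (hε : 0 < ε) :
    ∃ κ : ℝ → ℝ, IsWeilTest (fun t ↦ (κ t : ℂ)) ∧ (∀ t, 0 ≤ κ t ∧ κ t ≤ ε) ∧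
      (∀ t ∉ Ioo 0 (Real.log 2), κ t = 0) ∧ 1 ≤ ccN (toMul κ) := by
  obtain ⟨κ, hκ, h01, hs, hN⟩ := exists_ccN_toMul_ge (1 / ε)
  refine ⟨fun t ↦ ε * κ t, ?_, fun t ↦ ⟨mul_nonneg hε.le (h01 t).1, ?_⟩, fun t ht ↦ ?_, ?_⟩
  · simpa only [Complex.ofReal_mul] using hκ.const_mul (ε : ℂ)
  · calc ε * κ t ≤ ε * 1 := mul_le_mul_of_nonneg_left (h01 t).2 hε.le
      _ = ε := mul_one _
  · show ε * κ t = 0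
    rw [hs t ht, mul_zero]
  · rw [ccN_toMul_const_mul]
    calc (1 : ℝ) = ε * (1 / ε) := by field_simp
      _ ≤ ε * ccN (toMul κ) := mul_le_mul_of_nonneg_left hN hε.le

/-- **The `½ log(1/δ)` law.**  There is a family of real Weil tests `κ_δ` (`0 < δ ≤ (log 2)/4`:
the plateau bumps, values in `[0, 1]`, `= 1` on `[δ, δ + (log 2)/4]`, `= 0` off
`(δ/2, 3δ/2 + (log 2)/4) ⊂ (0, log 2)`) with `N(toMul κ_δ) / log(1/δ) → ½` as `δ → 0⁺`:
the mass of `N` on `(u, 2)` is `∼ ½ log(1/(u − 1))`.  PROVED. -/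
theorem exists_tendsto_ccN_toMul_div_log :
    ∃ κ : ℝ → ℝ → ℝ, (∀ δ, 0 < δ → δ ≤ Real.log 2 / 4 →
      IsWeilTest (fun t ↦ (κ δ t : ℂ)) ∧ (∀ t, 0 ≤ κ δ t ∧ κ δ t ≤ 1) ∧
        (∀ t ≤ δ / 2, κ δ t = 0) ∧ (∀ t, 3 * δ / 2 + Real.log 2 / 4 ≤ t → κ δ t = 0) ∧
        (∀ t ∈ Icc δ (δ + Real.log 2 / 4), κ δ t = 1) ∧
        |ccN (toMul (κ δ)) - 1 / 2 * Real.log (1 / δ)| ≤ 3) ∧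
      Tendsto (fun δ ↦ ccN (toMul (κ δ)) / Real.log (1 / δ)) (𝓝[>] 0) (𝓝 (1 / 2)) := by
  have hex : ∀ δ : ℝ, ∃ k : ℝ → ℝ, 0 < δ → δ ≤ Real.log 2 / 4 →
      IsWeilTest (fun t ↦ (k t : ℂ)) ∧ (∀ t, 0 ≤ k t ∧ k t ≤ 1) ∧
        (∀ t ≤ δ / 2, k t = 0) ∧ (∀ t, 3 * δ / 2 + Real.log 2 / 4 ≤ t → k t = 0) ∧
        (∀ t ∈ Icc δ (δ + Real.log 2 / 4), k t = 1) ∧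
        |ccN (toMul k) - 1 / 2 * Real.log (1 / δ)| ≤ 3 := by
    intro δ
    by_cases hδ : 0 < δ ∧ δ ≤ Real.log 2 / 4
    · obtain ⟨k, hk⟩ := exists_abs_ccN_toMul_sub_half_log_le hδ.1 hδ.2
      exact ⟨k, fun _ _ ↦ hk⟩
    · exact ⟨fun _ ↦ 0, fun h1 h2 ↦ (hδ ⟨h1, h2⟩).elim⟩
  choose κ hκ using hex
  refine ⟨κ, hκ, ?_⟩
  have hL : 0 < Real.log 2 := Real.log_pos one_lt_two
  have hlog : Tendsto (fun δ : ℝ ↦ Real.log (1 / δ)) (𝓝[>] 0) atTop := by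
    have h := Real.tendsto_log_nhdsGT_zero
    refine (tendsto_neg_atBot_atTop.comp h).congr' ?_
    filter_upwards [self_mem_nhdsWithin] with δ (hδ : 0 < δ)
    rw [Function.comp_apply, one_div, Real.log_inv]
  have hsmall : Tendsto (fun δ : ℝ ↦ 3 / Real.log (1 / δ)) (𝓝[>] 0) (𝓝 0) :=
    tendsto_const_nhds.div_atTop hlog
  have hev : ∀ᶠ δ in 𝓝[>] (0 : ℝ),
      |ccN (toMul (κ δ)) / Real.log (1 / δ) - 1 / 2| ≤ 3 / Real.log (1 / δ) := by
    filter_upwards [self_mem_nhdsWithin, hlog.eventually_gt_atTop 0,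
      mem_nhdsWithin_of_mem_nhds (Iic_mem_nhds (show (0 : ℝ) < Real.log 2 / 4 by positivity))]
      with δ (hδ : 0 < δ) hpos (hle : δ ≤ Real.log 2 / 4)
    have hb := (hκ δ hδ hle).2.2.2.2.2
    rw [div_sub' (ne_of_gt hpos), abs_div, abs_of_pos hpos, div_le_div_iff_of_pos_right hpos]
    simpa [mul_comm] using hb
  have h0 : Tendsto (fun δ ↦ ccN (toMul (κ δ)) / Real.log (1 / δ) - 1 / 2) (𝓝[>] 0) (𝓝 0) :=
    squeeze_zero_norm' (by simpa only [Real.norm_eq_abs] using hev) hsmall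
  have h1 := h0.add_const (1 / 2)
  simp only [sub_add_cancel, zero_add] at h1
  exact h1

/-! ## 3. The atoms of `N` at the prime powers -/

/-- Integers `m, n ≥ 1` with `|log m − log n| < log(1 + 1/n)` are equal.  PROVED. -/
private theorem oo_nat_eq_of_abs_log_sub_lt {m n : ℕ} (hm : 0 < m) (hn : 0 < n)
    (h : |Real.log m - Real.log n| < Real.log (1 + 1 / n)) : m = n := by
  have hm' : (0 : ℝ) < m := by exact_mod_cast hm
  have hn' : (0 : ℝ) < n := by exact_mod_cast hn
  have e : Real.log (1 + 1 / (n : ℝ)) = Real.log ((n : ℝ) + 1) - Real.log n := by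
    rw [← Real.log_div (by positivity) hn'.ne']
    congr 1
    field_simp
  rw [abs_lt, e] at h
  have h1 : (m : ℝ) < n + 1 := (Real.log_lt_log_iff hm' (by positivity)).1 (by linarith [h.2])
  have h2 : ((n : ℝ)) ^ 2 < m * (n + 1) := by
    rw [← Real.log_lt_log_iff (by positivity) (by positivity), Real.log_pow,
      Real.log_mul hm'.ne' (by positivity)]
    push_cast
    linarith [h.1]
  have h1' : m < n + 1 := by exact_mod_cast h1
  have h2' : n * n < m * (n + 1) := by
    have : ((n * n : ℕ) : ℝ) < ((m * (n + 1) : ℕ) : ℝ) := by push_cast; nlinarith [h2]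
    exact_mod_cast this
  by_contra hne
  have h3 : m + 1 ≤ n := by omega
  nlinarith

/-- **The atom of `N` at `u = n` has mass `Λ(n) n^{-1/2}` (Essay (27): `N = dφ/du + κ(u)`,
`φ(u) = Σ_{n<u} n Λ(n)`; unitary normalisation).**  If a real Weil test `0 ≤ κ ≤ 1` has
`κ(log n) = 1` and vanishes where `|t − log n| ≥ ε`, `0 < ε ≤ log(1 + 1/n)`, `n ≥ 2`, then
`|N(toMul κ) − Λ(n) n^{-1/2}| ≤ 2ε · w(log n − ε)`.  PROVED. -/
theorem abs_ccN_toMul_sub_vonMangoldt_le (hκ : IsWeilTest fun t ↦ (κ t : ℂ))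
    (h01 : ∀ t, 0 ≤ κ t ∧ κ t ≤ 1) {n : ℕ} (hn : 2 ≤ n) {ε : ℝ} (hε : 0 < ε)
    (hεn : ε ≤ Real.log (1 + 1 / n)) (hκ1 : κ (Real.log n) = 1)
    (hκε : ∀ t, ε ≤ |t - Real.log n| → κ t = 0) :
    |ccN (toMul κ) - Λ n / Real.sqrt n| ≤ 2 * ε * weilArchDensity (Real.log n - ε) := by
  have hn0 : (0 : ℝ) < n := by exact_mod_cast (show 0 < n by omega)
  have hn2 : (2 : ℝ) ≤ n := by exact_mod_cast hn
  have hL2 : Real.log 2 ≤ Real.log n := Real.log_le_log two_pos hn2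
  have hεlt : ε < Real.log n := by
    have h32 : Real.log (1 + 1 / (n : ℝ)) ≤ Real.log (3 / 2) :=
      Real.log_le_log (by positivity) (by
        have : (1 : ℝ) / n ≤ 1 / 2 := by
          rw [div_le_div_iff_of_pos_left one_pos hn0 two_pos]; exact hn2
        linarith)
    have h32' : Real.log (3 / 2) < Real.log 2 := Real.log_lt_log (by norm_num) (by norm_num)
    linarith
  have hκ0 : κ 0 = 0 := hκε 0 (by rw [zero_sub, abs_neg, abs_of_pos (by linarith)]; linarith)
  set a := (Real.log n + ε) / 2 with ha
  have hκa : ∀ t, 2 * a ≤ t → κ t = 0 := fun t ht ↦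
    hκε t (by rw [abs_of_nonneg (by linarith)]; linarith)
  rw [ccN_toMul_eq_sum_add_integral hκ hκ0 hκa]
  have hsum : ∑ m ∈ weilPrimeIndex a, (Λ m : ℝ) / Real.sqrt m * κ (Real.log m) =
      Λ n / Real.sqrt n := by
    rw [Finset.sum_eq_single n]
    · rw [hκ1, mul_one]
    · intro m _ hmn
      rcases Nat.eq_zero_or_pos m with rfl | hm
      · simp
      · by_cases hfar : ε ≤ |Real.log m - Real.log n|
        · rw [hκε _ hfar, mul_zero]
        · exact absurd (oo_nat_eq_of_abs_log_sub_lt hm (by omega)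
            ((not_le.1 hfar).trans_le hεn)) hmn
    · intro hnot
      exact absurd (mem_weilPrimeIndex.2 (by rw [ha]; linarith)) hnot
  rw [hsum, add_sub_cancel_left]
  -- the archimedean part lives on `(log n − ε, log n + ε)` where `w ≤ w(log n − ε)`
  have hint := integrableOn_weilArchDensity_mul hκ hκ0
  have heq : ∫ t in Ioi (0 : ℝ), weilArchDensity t * κ t =
      ∫ t in Ioo (Real.log n - ε) (Real.log n + ε), weilArchDensity t * κ t := by
    refine setIntegral_eq_of_subset_of_forall_sdiff_eq_zero measurableSet_Ioi
      (fun t ht ↦ mem_Ioi.2 (by linarith [ht.1])) fun t ht ↦ ?_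
    obtain ⟨-, ht⟩ := ht
    rw [mem_Ioo, not_and_or, not_lt, not_lt] at ht
    rw [hκε t (by rcases ht with ht | ht <;> [rw [abs_of_nonpos (by linarith)];
      rw [abs_of_nonneg (by linarith)]] <;> linarith), mul_zero]
  rw [heq]
  have hnn : 0 ≤ ∫ t in Ioo (Real.log n - ε) (Real.log n + ε), weilArchDensity t * κ t :=
    setIntegral_nonneg measurableSet_Ioo fun t ht ↦
      mul_nonneg (weilArchDensity_pos (by linarith [ht.1] : (0 : ℝ) < t)).le (h01 t).1
  rw [abs_of_nonneg hnn]
  have hbd : ∀ t ∈ Ioo (Real.log n - ε) (Real.log n + ε),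
      weilArchDensity t * κ t ≤ weilArchDensity (Real.log n - ε) := fun t ht ↦ by
    have hw : weilArchDensity t ≤ weilArchDensity (Real.log n - ε) :=
      (strictAntiOn_weilArchDensity.antitoneOn (mem_Ioi.2 (by linarith))
        (mem_Ioi.2 (by linarith [ht.1])) ht.1.le)
    calc weilArchDensity t * κ t ≤ weilArchDensity t * 1 :=
        mul_le_mul_of_nonneg_left (h01 t).2 (weilArchDensity_pos (by linarith [ht.1])).le
      _ ≤ weilArchDensity (Real.log n - ε) := by rw [mul_one]; exact hw
  have h := setIntegral_mono_on (hint.mono_set fun t ht ↦ mem_Ioi.2 (by linarith [ht.1]))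
    (integrableOn_const (by rw [Real.volume_Ioo]; exact ENNReal.ofReal_lt_top |>.ne))
    measurableSet_Ioo hbd
  refine h.trans (le_of_eq ?_)
  rw [setIntegral_const, Real.volume_real_Ioo_of_le (by linarith), smul_eq_mul]
  ring

end Summit.RiemannHypothesis.RiemannHypothesis.Theorems.MotivicDoor.ConnesConsani
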